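import Summits.BirchSwinnertonDyer.BirchSwinnertonDyer.Theorems.PrintX9JetchevSplitLocalFacts
import Summits.BirchSwinnertonDyer.BirchSwinnertonDyer.Theorems.KatoDescentPotSupersingularWildJetchevBoundAtPHeegnerE0ImageFree
import Summits.BirchSwinnertonDyer.BirchSwinnertonDyer.Theorems.Rank1ResidualJetCarrierMultEndForm
import Summits.BirchSwinnertonDyer.BirchSwinnertonDyer.Theorems.Rank1ResidualJetKodairaNeronCyclic
import Summits.BirchSwinnertonDyer.BirchSwinnertonDyer.Theorems.Rank1ResidualJetKolyvaginLocalTermClosed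
import Summits.BirchSwinnertonDyer.BirchSwinnertonDyer.Theorems.Rank1ResidualJetTransverseConj
import Summits.BirchSwinnertonDyer.BirchSwinnertonDyer.Theorems.Rank1ResidualJetTransverseClass
import Summits.BirchSwinnertonDyer.Rank1Residual.JET.RingClassTransverseSelfDualForall
import Literature.NumberTheory.EllipticCurves.Rank1Residual.Predicates
import Literature.NumberTheory.EllipticCurves.ModularityVersionApProofs
import HarnessLib

/-!
# Route `PrintX9`, crux J = `HeegnerDivisibilityX9` (item 20392), stub `stub_jetchevX9`: THE X9 NODE `H63X9` —
# Jetchev 2008 Thm. 5.2 (= arXiv Thm. 6.3: at a minimal core vertex of high level, `ord_p c_q(E) ≤ m_∞`) for the ROW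
# OBJECTS of class X9 (`ClassX9 W p`: good ordinary `p ≥ 5`, `E[p]` irreducible, `ρ̄_{E,p}` NOT onto; `K` Heegner for
# `N_E` with `p` SPLIT and `d_K ∉ {−3,−4}`; carrier any prime `q ∣ N_E`), KERNEL THEOREM MODULO NAMED PRINT ONLY:
# {Gross 1991 Prop. 3.7 (2), Poitou–Tate duality for Selmer structures, [GZ86 III (3.1)] image-free} — three Literature facts

Cell `bsd-print-x9` (print tier, key `x9`), prover seat p4; `--supports stmt-BirchSwinnertonDyer-20392`,
helper; THEOREMS ONLY, nothing booked, no item closed, BSD is not proved by any of this.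

WHY. The registered stub `stub_jetchevX9` of crux J (Jetchev's Thm. 1.4 `m_∞ ≥ ord_p c_q`, one carrier `q ∣ N_E` at a
time, read at IRREDUCIBLE NON-surjective image) decomposes, exactly as bsd-jet's road K for the surjective rows and
bsd-potss' crux 20165 for the additive-`p` irreducible rows, into (a) THIS node (Thm. 5.2 at a core vertex), (b) the
existence of core vertices of every level (Jetchev Prop. 5.3 = arXiv Prop. 6.4, the walk), (c) Kolyvagin's redefinition of
`m_∞` (McCallum 1991 Prop. 5.2, the prime swap — NOT print at non-surjective image), (d) bsd-jet's abstract §6 deduction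
(`JET.Section6.depth_le_mdiv_of_coreVertices`). The image of `ρ̄_{E,p}` enters (a) only through the Čebotarev Lemma 6.1
and the admissibility `E(K[c])[p^k] = 0`, both UNCONDITIONAL on X9 frames (ty2's discharge interface, files E/F/H:
`ClassX9.exists_kolyvaginPrime_addOrderOf_localization_eq_of_heegner`; x11b3's irreducible no-torsion theorem with `p`
split ⇒ unramified). WHAT IS PROVED. `h63X9_of_namedFacts`: the X9 twin of potss k9-c4 g10's node
`JetchevIrreducibleReadingThm52Gross1991.h63IRowObjectsAddv_of_poitouTate_of_Gross1991_of_prop47P2` — statement = potss' `Sig.H63IRowObjectsAddv`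
with the row binders `¬CM, p ≠ 2, Addv, ord_p j ≥ 0, Irr, p ∤ c_p, additive-carrier guard, q ∥ N, q ≠ p` replaced by
`ClassX9 W p ∧ SatisfiesHeegnerHypothesis p K` (the carrier `q ∣ N_E` arbitrary: `q ≠ p` is automatic and the proof never
used `q ∥ N`), proof byte-for-byte over the X9 layer 3 (`JET.Split.tamagawaExponent_le_mInfty_of_localFacts_of_classX9_of_heegner`)
with the reading `h47P2` replaced by the named fact `h37` and the receptacle schema fed in frame from `hF1`. HYPOTHESES (three
named Literature facts, nothing else): `h37` (`GrossLMS1991.prop37_2_frobeniusCongruence`), `hPT`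
(`poitouTate_selmerStructure_duality_conj`), `hF1` (`Gross1991_heegnerPoint_sub_ratTorsion_mem_E0_imageFree`, [GZ86 III (3.1)]
as Gross 1991 §6 uses it, typed image-free by bsd-potss k9-c4). CONDITIONAL on those three; nothing asserted about any curve; beyond-print: the node itself is Jetchev's
Thm. 5.2 at non-surjective irreducible image, which is not in print (Jetchev 2008 Hypothesis (∗) = surjective).

References: [cite: Jetchev2008, Thm. 5.2 (p. 821), Thm. 1.4, Prop. 4.7, Prop. 4.9, Lemma 5.1, Rem. 6.2] [cite: McCallumLMS1991,
§3 Cor. 3.2, §4 Prop. 4.4] [cite: GrossLMS1991, §3, Prop. 3.7 (2), Prop. 5.3, Prop. 6.2] [cite: GrossZagier1986, III (3.1)]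
[cite: MilneADT2006, Ch. I, Thm. 4.10(b)] [cite: Howard2004HeegnerKolyvagin, Prop. 2.1.9 (ii), Lemma 2.7.3].
-/


set_option autoImplicit false
noncomputable section

open scoped Classical Pointwise

open WeierstrassCurve IsDedekindDomain NumberField Field Literature.NumberTheory.EllipticCurves
  Literature.NumberTheory.EllipticCurves.ModularForms Literature.NumberTheory.EllipticCurves.Jetchev2008
  Literature.NumberTheory.GaloisRepresentations Literature.NumberTheory.GaloisCohomology
  Literature.NumberTheory.GaloisRepresentations.DiscreteGaloisModule
  Summit.BirchSwinnertonDyer.Rank1Residual.X11b Summit.BirchSwinnertonDyer.Rank1Residual.X11b.Three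
  Summit.BirchSwinnertonDyer.Rank1Residual.JET
  Summit.BirchSwinnertonDyer.Rank1Residual.JET.SelmerVocabulary Literature.NumberTheory.Automorphic
  Summit.BirchSwinnertonDyer.BirchSwinnertonDyer.Theorems Literature.NumberTheory.EllipticCurves.Rank1Residual

namespace Summit.BirchSwinnertonDyer.Rank1Residual.JET.Split

/-- **`H63X9` ⟸ THREE NAMED LITERATURE FACTS {`h37` Gross 3.7 (2), `hPT` Poitou–Tate, `hF1` [GZ86 III (3.1)] image-free} ONLY**: Jetchev's Thm. 5.2 — at a core vertex `c` of level
`k > max(ord_p c_q, m_∞)` with `m(c) = m_∞` and `k + m_∞ ≤ M(c)`, `ord_p c_q(E) ≤ m_∞` — for every X9 pair `(E, p)`,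
every Heegner field `K` of `N_E` with `p` split and `d_K ∉ {−3,−4}`, every frame `(Dt, β, ι)` with a non-torsion basic
Heegner point, every carrier prime `q ∣ N_E`, every pair of divisibility-index functions `m′`, `m` with minimum `m_∞`
attained cofinally. X9 twin of potss' `h63IRowObjectsAddv_of_poitouTate_of_GZ31_of_prop47P2` (proof byte-for-byte over
`tamagawaExponent_le_mInfty_of_localFacts_of_classX9_of_heegner`; `hloc`, `h𝒯σ`, `h𝒯sd`, `htr` by
`JET.kolyvaginLocalTerm_of_poitouTate`, `JET.conjActPlace_mem_transverseFamily_forall`,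
`JET.RingClassTransverse.localTransverseFamily_selfDual_forall`, `JET.kolyvaginClass_mem_transverseKer`; `Φ_q` cyclic by
`JET.kodairaNeron_isAddCyclic_forall`; the carrier place by `exists_split_place_of_dvd` / `carrierRowData_of_split`).
CONDITIONAL on the three named facts; nothing asserted about any curve.
[cite: GrossLMS1991, §6, proof of Prop. 6.2 (1), p. 245] [cite: Jetchev2008, Thm. 5.2 (p. 821), Thm. 1.4, Prop. 4.9] [cite: McCallumLMS1991, §4 Prop. 4.4] [cite: Howard2004HeegnerKolyvagin, Prop. 2.1.9 (ii), Lemma 2.7.3] -/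
theorem h63X9_of_namedFacts
    -- NAMED PRINT: Gross 1991 Prop. 3.7 (2) (image-free Eichler–Shimura congruence; feeds Jetchev Prop. 4.7)
    (h37 : GrossLMS1991.prop37_2_frobeniusCongruence)
    -- NAMED PRINT: Poitou–Tate duality for the tree's Selmer structures (named fact, bsd-jet ARM P); Gross Prop. 5.3 is no
    -- longer displayed (the sign is a theorem on the irreducible row), nor is any completion-layer gap
    (hPT : ∀ (K : Type) [Field K] [NumberField K], poitouTate_selmerStructure_duality_conj K)
    -- NAMED LITERATURE FACT: [GZ86 III (3.1)] «y_n − (rational torsion) ∈ E⁰(K[n]_w)» image-free (Gross 1991 §6 p. 245),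
    -- feeding the receptacle schema in frame through `HeegnerE0ImageFree.hGZ_of_Gross1991_imageFree` (witness `n' = #E(ℚ)_tors`,
    -- prime to `p` by irreducibility)
    (hF1 : Gross1991_heegnerPoint_sub_ratTorsion_mem_E0_imageFree) :
    -- CONCLUSION: the X9 node `H63X9` (X9 twin of the body of potss' `Sig.H63IRowObjectsAddv`)
    ∀ (W : WeierstrassCurve ℚ) [W.IsElliptic] [W.IsGloballyMinimal] [NeZero (W.conductorNorm ℤ)],
    ∀ (K : Type) [Field K] [NumberField K], IsImaginaryQuadratic K →
    NumberField.discr K ≠ -3 → NumberField.discr K ≠ -4 →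
    SatisfiesHeegnerHypothesis (W.conductorNorm ℤ) K →
    ∀ (τ : K ≃ₐ[ℚ] K), τ ≠ 1 →
    ∀ (p : ℕ) [Fact p.Prime], ClassX9 W p → SatisfiesHeegnerHypothesis p K →
    ∀ (Dt : ModularParametrizationData W (W.conductorNorm ℤ)) (β : ℤ) (ι : K →+* ℂ)
      [∀ k : ℕ, NumberField (ringClassField K ι k)]
      (d₁ : KolyvaginHeegnerData Dt β ι 1), ¬ IsOfFinAddOrder d₁.derivedPoint →
    ∀ (q : ℕ) [Fact q.Prime], q ∣ W.conductorNorm ℤ →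
    ∀ (mdiv m : {c : ℕ // Squarefree c ∧ ∀ ℓ ∈ c.primeFactors,
        Zhang2014.IsKolyvaginPrime (W.conductorNorm ℤ) W K p ℓ} → ℕ∞),
    (∀ c (u : ℕ), (u : ℕ∞) ≤ mdiv c ↔ ∀ d : KolyvaginHeegnerData Dt β ι c.1,
      ∃ Q : (W.baseChange (ringClassField K ι c.1)).toAffine.Point,
        ((p ^ u : ℕ) : ℤ) • Q = d.derivedPoint) →
    (∀ c, m c = if mdiv c < Zhang2014.levelIndex W p c.1 then mdiv c else ⊤) →
    ∀ mInf : ℕ, (∀ c, (mInf : ℕ∞) ≤ m c) →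
      (∀ m' : ℕ, ∃ c, (m' : ℕ∞) ≤ Zhang2014.levelIndex W p c.1 ∧ m c = mInf) →
    ∀ (k : ℕ) c, 1 ≤ k → Jetchev2008.IsGlobalCoreVertex W K ι τ p k c.1 → m c = mInf →
      (k : ℕ∞) + mInf ≤ Zhang2014.levelIndex W p c.1 →
      padicValNat p ((W.baseChange ℚ_[q]).localTamagawaNumber ℤ_[q]) < k → mInf < k →
      padicValNat p ((W.baseChange ℚ_[q]).localTamagawaNumber ℤ_[q]) ≤ mInf := by
  intro W _ _ _ K _ _ hK hD3 hD4 hH τ hτ p _ hX9 hHp Dt β ι _ d₁ _ q _ hq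
    mdiv m hmdiv hm mInf _ _ k c hk hcore hmc hkM htk hik
  have hp : p.Prime := Fact.out
  have hp2 : p ≠ 2 := hX9.ne_two
  have hD : NumberField.discr K < -4 := KolyvaginAssembly.discr_lt_neg_four hK ⟨hD3, hD4⟩
  -- trivial case: `p ∤ c_q`
  by_cases ht0 : padicValNat p ((W.baseChange ℚ_[q]).localTamagawaNumber ℤ_[q]) = 0
  · rw [ht0]; exact Nat.zero_le _
  have hdvd : p ∣ (W.baseChange ℚ_[q]).localTamagawaNumber ℤ_[q] :=
    dvd_of_one_le_padicValNat (Nat.one_le_iff_ne_zero.mpr ht0)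
  -- the carrier place `v₀ ∣ q`, split, and the transport of the row data
  obtain ⟨v₀, hv₀, hv₀N, hqv₀⟩ := exists_split_place_of_dvd K hK τ hτ hH q hq
  obtain ⟨hminK, hminP, hcEq, hc0, hcyc⟩ := carrierRowData_of_split W K q hK τ v₀ hv₀ hqv₀
  haveI := hminK
  haveI := hminP
  haveI := hcyc (kodairaNeron_isAddCyclic_forall W q p hp2 hdvd)
  -- `τ² = 1`
  haveI : Algebra.IsQuadraticExtension ℚ K := ⟨hK.1⟩
  have hτ2 : τ * τ = 1 := by
    have hcard : Nat.card (K ≃ₐ[ℚ] K) = 2 := by rw [IsGalois.card_aut_eq_finrank, hK.1]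
    obtain ⟨y, -, hyu⟩ := (Nat.card_eq_two_iff' (1 : K ≃ₐ[ℚ] K)).mp hcard
    have h1 : τ = y := hyu τ hτ
    have h2 : τ⁻¹ = y := hyu τ⁻¹ (inv_ne_one.mpr hτ)
    rw [mul_eq_one_iff_eq_inv]
    exact h1.trans h2.symm
  -- instances at level `p^k`
  haveI : NeZero (p ^ k) := ⟨pow_ne_zero k hp.ne_zero⟩
  haveI : Finite (geomTorsion (W.baseChange K) ((p ^ k : ℕ) : ℤ)) :=
    finite_geomTorsion_of_neZero (W.baseChange K) (p ^ k)
  have hn : ((p ^ k : ℕ) : ℤ) ≠ 0 := by exact_mod_cast pow_ne_zero k hp.ne_zero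
  -- the receptacle schema [GZ86 III (3.1)] at this frame, from the image-free named fact
  obtain ⟨n', hcop', hGZ'⟩ := HeegnerE0ImageFree.hGZ_of_Gross1991_imageFree hF1 W K hK hD3 hD4 hH p hp2 hX9.irr Dt β ι
  -- Kolyvagin data of the core vertex
  have hc0' : c.1 ≠ 0 := c.2.1.ne_zero
  have hkc : (k : ℕ∞) ≤ Zhang2014.levelIndex W p c.1 := le_trans le_self_add hkM
  have hcK : ∀ ℓ ∈ c.1.primeFactors, Zhang2014.IsKolyvaginPrime (W.conductorNorm ℤ) W K p ℓ ∧
      k ≤ Zhang2014.kolyvaginIndex W p ℓ := fun ℓ hℓ ↦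
    ⟨c.2.2 ℓ hℓ, Zhang2014.natCast_le_levelIndex_iff.mp hkc ℓ hℓ⟩
  -- the exponent over `K_{v₀}` is the exponent over `ℚ_q`
  have hfac : (((W.baseChange K).baseChange (v₀.adicCompletion K)).localTamagawaNumber
      (v₀.adicCompletionIntegers K)).factorization p =
      padicValNat p ((W.baseChange ℚ_[q]).localTamagawaNumber ℤ_[q]) := by
    rw [hcEq, Nat.factorization_def _ hp]
  have htk' : (((W.baseChange K).baseChange (v₀.adicCompletion K)).localTamagawaNumber
      (v₀.adicCompletionIntegers K)).factorization p < k := by rw [hfac]; exact htk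
  -- the intrinsic transverse family (for `h49tr` from `htr` at level `cℓ`)
  obtain ⟨𝒯, h𝒯, hT⟩ := exists_localTransverseFamily W ι ((p ^ k : ℕ) : ℤ) hc0'
  have key := tamagawaExponent_le_mInfty_of_localFacts_of_classX9_of_heegner h37 W
    K hK hD3 hD4 hH
    (hPT K) p hp2 hX9 hHp Dt β ι τ hτ hτ2 hcop' hGZ' mdiv m hmdiv hm k hn c hk hcore mInf hmc hkM hik
    v₀ hv₀ hv₀N hc0 htk'
    (fun 𝒯' h𝒯' ↦ conjActPlace_mem_transverseFamily_forall W K hK ι τ hτ p k hp2 c.1 c.2.1 hcK 𝒯' h𝒯')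
    (fun 𝒯' h𝒯' e hμ hadd₁ hadd₂ hgal halt hnondeg ↦
      RingClassTransverse.localTransverseFamily_selfDual_forall W K hK hD3 hD4 ι p k hp2 c.1 c.2.1 hcK 𝒯' h𝒯'
        e hμ hadd₁ hadd₂ hgal halt hnondeg)
    (fun ℓ h1 h2 _ v hv hfix s hs ↦
      kolyvaginLocalTerm_of_poitouTate hPT W K hK τ hτ p k hp2 hk ℓ h1 h2 v hv hfix s hs)
    (fun d ℓ hℓ ↦ kolyvaginClass_mem_transverseKer W hK hD hp2 Dt β ι k c.2.1 hcK d hℓ)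
    (fun ℓ h1 h2 h3 d' w hw ↦ by
      -- `h49tr` from `htr` at level `cℓ` through the reconciliation `hT`
      have hl : ℓ.Prime := h1.1
      have hlc : ¬ ℓ ∣ c.1 := fun h ↦ h3 (Nat.mem_primeFactors.mpr ⟨hl, h, hc0'⟩)
      have hcl : Squarefree (c.1 * ℓ) :=
        (Nat.squarefree_mul ((Nat.Prime.coprime_iff_not_dvd hl).mpr hlc).symm).mpr ⟨c.2.1, hl.squarefree⟩
      have hpf : (c.1 * ℓ).primeFactors = c.1.primeFactors ∪ {ℓ} := by
        rw [Nat.primeFactors_mul hc0' hl.ne_zero, hl.primeFactors]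
      have hcKℓ : ∀ l' ∈ (c.1 * ℓ).primeFactors, Zhang2014.IsKolyvaginPrime (W.conductorNorm ℤ) W K p l' ∧
          k ≤ Zhang2014.kolyvaginIndex W p l' := by
        intro l' hl'
        rw [hpf, Finset.mem_union, Finset.mem_singleton] at hl'
        rcases hl' with h | rfl
        · exact hcK l' h
        · exact ⟨h1, h2⟩
      rw [← h𝒯 w]
      refine (hT _).mpr (fun l' hl' ↦ ?_) w hw
      exact kolyvaginClass_mem_transverseKer W hK hD hp2 Dt β ι k hcl hcKℓ d'
        (by rw [hpf]; exact Finset.mem_union_left _ hl'))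
  rw [hfac] at key
  exact key

end Summit.BirchSwinnertonDyer.Rank1Residual.JET.Split

end
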